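import Literature.MathematicalPhysics.QuantumLattice.KomaPiFluxLatticeConstantBound
import HarnessLib

/-!
# Koma 2022, Theorem 2.1: superconducting long-range order of the `π`-flux BCS lattice fermions at low
# temperature and small `|κ|/g`, in every dimension `D ≥ 3` (Lieb frame)

T. Koma, *Nambu–Goldstone modes for superconducting lattice fermions*, arXiv:2201.13135 (2022)
[Koma2022], Theorem 2.1: "Let `d ≥ 3`, and set the external symmetry-breaking field to be `B = 0`.
Then, there exist small positive numbers `κ̂` and `ĝ'`, and a large positive number `β_c` such that
`m_LRO > 0` for `|κ|/g ≤ κ̂` and `g'/g ≤ ĝ'`, and `β ≥ β_c`. … Here, `κ̂` and `ĝ'` can be chosen to be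
independent of the model parameters, `κ, g, g'`, but `β_c` depends on the model parameters." — proved
here for `g' = 0` (Koma §3: "We will consider first the case with `g' = 0`"), from (6.34)–(6.36):
`√E₁(√E₁ - I_d/√2) - δ(β) - I_d√(|κ|/g) ≤ (m_LRO)²`, `E₁ ≥ ½ - δ̃(β)/(dg) - |κ|/g`.  The Coulomb repulsion
`g' > 0` of (2.6)/§8 is carried through the same chain in the companion files `KomaPiFluxCoulomb*`
(`KomaPiFlux.superconductingOrder_coulomb`, `KomaPiFlux.printed_superconductingOrder_coulomb`:
`|κ| ≤ g/1000`, `0 ≤ g' ≤ g/2000`).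

This file closes the chain `BCSPairHoppingReflectionPositivity` → `KomaPiFluxBCSModel` →
`KomaPiFluxGaussianDomination` → `KomaPiFluxInfraredBound` → … → `KomaPiFluxLongRangeOrderBound` →
`KomaPiFluxLatticeConstantBound` (reflection positivity (5.99), Gaussian domination Thm 5.3, the
infrared bound (6.4)/(6.9), the sum rule (6.17)–(6.20), the double-commutator bounds (6.25)–(6.33),
Appendix B, and the lattice constant `I_d`, all in Lieb's reflection frame on the even torus
`(ℤ/Lℤ)^D`, `D = d + 1` directions, side `L = 2k`). In that frame the model is
`H₀ = KomaPiFlux.hamiltonian κ U g 0 0 = K(T_π(κ)) + UΣ(n-½)(n-½) + (g/8)Σ_{x∼y}{[Γ¹_x-Γ¹_y]² + [Γ²_x-Γ²_y]²}`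
and Koma's printed Hamiltonian (2.4)–(2.9) is unitarily equivalent to `H₀` with `U = -2Dg`, up to an
additive constant (`KomaPiFluxPrintedModel.orbitalPhaseAut_hamiltonian_eq_printed`); the order parameter
is `m² = lroSq β H₀ = |Λ|⁻²Σ_{x,y}Re⟨Γ¹_xΓ¹_y⟩_β` ((6.18)–(6.19) without the staggering, removed by the
sublattice rotation (6.5)).

* `lro_endgame` — the elementary step behind (6.35): from
  `m² ≥ E₁ - T - ½√I²√(8κ/g + 4E₁)` ((6.34)), `E₁ ≥ σ` and `I² ≤ 4(σ + 2κ/g)`, monotonicity of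
  `t ↦ t - I√t` gives `m² ≥ σ - I√(σ + 2κ/g) - T` (Kennedy–Lieb–Shastry's monotone step);
* **`superconductingOrder`** — THEOREM 2.1 (this series' constants): in `D = d + 1 ≥ 3` directions,
  for `g > 0`, `0 ≤ κ ≤ g/1000` and `U ≤ -2Dg` (the printed model is `U = -2Dg`), there are `β₀ > 0`
  (depending on `g`, `D`) and `k₀` such that for all `β ≥ β₀` and all `k ≥ k₀`
  **`lroSq β H₀ ≥ 1/2000` on the torus of side `2k`** — long-range order uniformly in the volume;
  `κ̂ = 1/1000` is independent of the model parameters and `β₀ = 1000(log 4/(gD) + (R(D)+1)/g) + 1`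
  depends on them, exactly as printed. Ingredients: `lroSq_ge` ((6.34)), `nnCorr_ge` ((6.36)),
  `idSq_eventually_le_const` (`I² ≤ 0.487`, all `D ≥ 3`), `thermalSum_div_eventually_le`.

The sign of `κ` is a gauge (`KomaPiFluxPrintedModel.partitionFn_neg_kappa`); the statement for the
printed Hamiltonian and `|κ| ≤ g/1000` is the business of the companion transport file. No named fact.

## References

* [Koma2022] T. Koma, arXiv:2201.13135, Theorem 2.1, (6.34)–(6.36).
* [KLS1988PRL] T. Kennedy, E. H. Lieb, B. S. Shastry, Phys. Rev. Lett. 61 (1988) 2582, after eq. (8)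
  (the monotone step).
* [DLS1978] F. J. Dyson, E. H. Lieb, B. Simon, J. Stat. Phys. 18 (1978) 335, Thm. 5.1 (positive
  temperature).
-/

noncomputable section

namespace Literature.MathematicalPhysics.QuantumLattice

open Matrix Finset Filter HubbardWave0 PairHopRP FermionTorus LiebCutRP
open Literature.Probability.LatticeModels

namespace KomaPiFlux

variable {d : ℕ}

/-- **The monotone step behind (6.35).** If `m ≥ E - T - ½√I√(8κ' + 4E)`, `E ≥ σ`, `I ≤ 4(σ + 2κ')`
and `σ + 2κ' ≥ 0`, then `m ≥ σ - √I√(σ + 2κ') - T` (`t ↦ t - √I√(t + 2κ')` is non-decreasing on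
`t + 2κ' ≥ I/4`; Kennedy–Lieb–Shastry's `kls_monotone_step`). [cite: Koma2022, (6.34)–(6.35)]
[cite: KLS1988PRL, after eq. (8)] -/
theorem lro_endgame {m E T I κ' σ : ℝ} (hσ : 0 ≤ σ + 2 * κ')
    (hIσ : I ≤ 4 * (σ + 2 * κ')) (hσE : σ ≤ E)
    (hm : E - T - 1 / 2 * Real.sqrt I * Real.sqrt (8 * κ' + 4 * E) ≤ m) :
    σ - Real.sqrt I * Real.sqrt (σ + 2 * κ') - T ≤ m := by
  have h2 : Real.sqrt 4 = 2 := by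
    rw [show (4 : ℝ) = 2 ^ 2 by norm_num, Real.sqrt_sq (by norm_num)]
  have h4 : Real.sqrt (8 * κ' + 4 * E) = 2 * Real.sqrt (E + 2 * κ') := by
    rw [show 8 * κ' + 4 * E = 4 * (E + 2 * κ') by ring, Real.sqrt_mul (by norm_num), h2]
  have hR : 2 * Real.sqrt I ≤ 4 * Real.sqrt (σ + 2 * κ') := by
    have h := Real.sqrt_le_sqrt hIσ
    rw [Real.sqrt_mul (by norm_num), h2] at h
    linarith
  have hstep := kls_monotone_step hσ (by linarith : σ + 2 * κ' ≤ E + 2 * κ') hR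
  have e1 : 1 / 2 * Real.sqrt I * (2 * Real.sqrt (E + 2 * κ')) = Real.sqrt (E + 2 * κ') * Real.sqrt I := by
    ring
  have e2 : 1 / 2 * Real.sqrt (σ + 2 * κ') * (2 * Real.sqrt I) = Real.sqrt I * Real.sqrt (σ + 2 * κ') := by
    ring
  have e3 : 1 / 2 * Real.sqrt (E + 2 * κ') * (2 * Real.sqrt I) = Real.sqrt (E + 2 * κ') * Real.sqrt I := by
    ring
  rw [h4, e1] at hm
  rw [e2, e3] at hstep
  linarith

/-- `√(0.487)·√(1/2) ≤ 0.4935` (numerics of the margin). [cite: Koma2022, after (6.36)] -/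
private theorem sqrt_margin_le : Real.sqrt (487 / 1000) * Real.sqrt (1 / 2) ≤ 4935 / 10000 := by
  rw [← Real.sqrt_mul (by norm_num), Real.sqrt_le_left (by norm_num)]
  norm_num

/-- **Koma's Theorem 2.1 (superconducting long-range order), Lieb frame, every dimension `D = d + 1 ≥ 3`.**
For `g > 0`, `0 ≤ κ ≤ g/1000` and `U + 2g(d+1) ≤ 0` (the printed model has `U = -2g(d+1)`) there are
`β₀ > 0` and `k₀` such that for every inverse temperature `β ≥ β₀` and every `k ≥ k₀` the Gibbs state of
`H₀ = H(κ, U, g; h = 0, B = 0)` on the torus of side `2k` has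
`m² = |Λ|⁻²Σ_{x,y}Re⟨Γ¹_xΓ¹_y⟩_β ≥ 1/2000`: the superconducting long-range order is bounded below
uniformly in the volume (`κ̂ = 1/1000` universal; `β₀` depends on `g` and `D`).
[cite: Koma2022, Theorem 2.1, (6.34)–(6.36)] [cite: DLS1978, Thm. 5.1] -/
theorem superconductingOrder (hd : 2 ≤ d) {κ U g : ℝ} (hg : 0 < g) (hκ : 0 ≤ κ) (hκg : κ ≤ g / 1000)
    (hU : U + 2 * g * (d + 1) ≤ 0) :
    ∃ β₀ : ℝ, ∃ k₀ : ℕ, 0 < β₀ ∧ ∀ β : ℝ, β₀ ≤ β → ∀ k : ℕ, k₀ ≤ k → ∀ [NeZero (2 * k)],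
      (1 / 2000 : ℝ) ≤ lroSq β (hamiltonian κ U g (fun (_ _ : FermionTorus (d + 1) (2 * k)) => (0 : ℝ)) 0) := by
  obtain ⟨k₁, hk₁⟩ := idSq_eventually_le_const (d := d) hd
  obtain ⟨k₂, hk₂⟩ := thermalSum_div_eventually_le (d := d) hd
  set 𝒯 : ℝ := latticeGreen (0 : Site (d + 1)) + 1 with h𝒯
  set ℓ : ℝ := Real.log 4 / (g * (d + 1)) with hℓ
  have hD : (0 : ℝ) < (d + 1 : ℝ) := by positivity
  have hlog4 : 0 ≤ Real.log 4 := Real.log_nonneg (by norm_num)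
  have hℓ0 : 0 ≤ ℓ := by rw [hℓ]; positivity
  -- `𝒯 ≥ 0`: it dominates a thermal sum, which is nonnegative
  have h𝒯0 : 0 ≤ 𝒯 := by
    haveI : NeZero (2 * (k₂ + 1)) := ⟨by omega⟩
    refine le_trans ?_ (hk₂ (k₂ + 1) (by omega))
    refine div_nonneg (Finset.sum_nonneg fun q _ => div_nonneg (le_max_right _ _) (dispersion_nonneg _)) ?_
    positivity
  set β₀ : ℝ := 1000 * (ℓ + 𝒯 / g) + 1 with hβ₀
  have hβ₀pos : 0 < β₀ := by rw [hβ₀]; positivity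
  refine ⟨β₀, max k₁ (max k₂ 2), hβ₀pos, fun β hβ k hk _ => ?_⟩
  have hβ : 0 < β := hβ₀pos.trans_le hβ
  have hk1 : k₁ ≤ k := le_trans (le_max_left _ _) hk
  have hk2 : k₂ ≤ k := le_trans (le_max_left _ _) ((le_max_right _ _).trans hk)
  have hk2' : 2 ≤ k := le_trans (le_max_right _ _) ((le_max_right _ _).trans hk)
  set H₀ := hamiltonian κ U g (fun (_ _ : FermionTorus (d + 1) (2 * k)) => (0 : ℝ)) 0 with hH₀
  -- the two finite-volume inequalities (6.34), (6.36)
  have h34 := lroSq_ge (d := d) (L := 2 * k) (even_two_mul k) (by omega) hβ hκ U hg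
  have h36 := nnCorr_ge (d := d) (L := 2 * k) (even_two_mul k) (by omega) hβ hκ U hg
  rw [← hH₀] at h34 h36
  rw [max_eq_right hU, zero_div, sub_zero] at h36
  -- the lattice sums
  have hI := hk₁ k hk1
  have hT := hk₂ k hk2
  set N : ℝ := ((2 * k : ℕ) : ℝ) ^ (d + 1) with hN
  have hNpos : 0 < N := by rw [hN]; positivity
  -- normalise the thermal term: `thermalSum/(βg(DN)) = (thermalSum/(DN))/(βg) ≤ 𝒯/(βg)`
  have hTβ : thermalSum d (2 * k) / (β * g * ((d + 1) * N)) ≤ 𝒯 / (β * g) := by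
    rw [show thermalSum d (2 * k) / (β * g * ((d + 1) * N)) =
        thermalSum d (2 * k) / ((d + 1) * N) / (β * g) by
      rw [div_div, mul_comm ((d + 1 : ℝ) * N)]]
    exact div_le_div_of_nonneg_right hT (by positivity)
  -- the endgame with `σ = ½ - 4κ/g - ℓ/β`, `κ' = κ/g`
  set κ' : ℝ := κ / g with hκ'
  have hκ'0 : 0 ≤ κ' := by rw [hκ']; positivity
  have hκ'1 : κ' ≤ 1 / 1000 := by rw [hκ', div_le_iff₀ hg]; linarith
  have hℓβ : Real.log 4 / (β * g * (d + 1)) = ℓ / β := by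
    rw [hℓ]; field_simp
  -- `(ℓ + 𝒯/g)/β ≤ 1/1000`
  have hsmall : ℓ / β + 𝒯 / (β * g) ≤ 1 / 1000 := by
    have h1 : ℓ / β + 𝒯 / (β * g) = (ℓ + 𝒯 / g) / β := by field_simp
    rw [h1, div_le_iff₀ hβ]
    have : 1000 * (ℓ + 𝒯 / g) ≤ β := by linarith
    linarith
  have hℓβ0 : 0 ≤ ℓ / β := by positivity
  have h𝒯β0 : 0 ≤ 𝒯 / (β * g) := by positivity
  set σ : ℝ := 1 / 2 - 4 * κ' - ℓ / β with hσ
  have h4κ : 4 * κ / g = 4 * κ' := by rw [hκ']; ring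
  rw [h4κ, hℓβ] at h36
  have h8κ : 8 * κ / g = 8 * κ' := by rw [hκ']; ring
  rw [h8κ] at h34
  have hσE : σ ≤ nnCorr β H₀ := by rw [hσ]; linarith
  have hσ2 : 0 ≤ σ + 2 * κ' := by rw [hσ]; linarith
  have hσhalf : σ + 2 * κ' ≤ 1 / 2 := by rw [hσ]; linarith
  have hIσ : idSq d (2 * k) ≤ 4 * (σ + 2 * κ') := by rw [hσ]; linarith
  have hend := lro_endgame (T := thermalSum d (2 * k) / (β * g * ((d + 1) * N))) hσ2 hIσ hσE h34
  -- `√I √(σ + 2κ') ≤ √0.487 · √(1/2) ≤ 0.4935`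
  have hroot : Real.sqrt (idSq d (2 * k)) * Real.sqrt (σ + 2 * κ') ≤ 4935 / 10000 :=
    (mul_le_mul (Real.sqrt_le_sqrt hI) (Real.sqrt_le_sqrt hσhalf) (Real.sqrt_nonneg _)
      (Real.sqrt_nonneg _)).trans sqrt_margin_le
  rw [hσ] at hend
  linarith

/-- The same, as an eventual statement along the even sides `L = 2k` (`Filter.atTop`).
[cite: Koma2022, Theorem 2.1] -/
theorem superconductingOrder_eventually (hd : 2 ≤ d) {κ U g : ℝ} (hg : 0 < g) (hκ : 0 ≤ κ)
    (hκg : κ ≤ g / 1000) (hU : U + 2 * g * (d + 1) ≤ 0) :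
    ∃ β₀ : ℝ, 0 < β₀ ∧ ∀ β : ℝ, β₀ ≤ β → ∀ᶠ k : ℕ in atTop, ∀ [NeZero (2 * k)],
      (1 / 2000 : ℝ) ≤ lroSq β (hamiltonian κ U g (fun (_ _ : FermionTorus (d + 1) (2 * k)) => (0 : ℝ)) 0) := by
  obtain ⟨β₀, k₀, hβ₀, h⟩ := superconductingOrder hd hg hκ hκg hU
  exact ⟨β₀, hβ₀, fun β hβ => (eventually_ge_atTop k₀).mono fun k hk => h β hβ k hk⟩

end KomaPiFlux

end Literature.MathematicalPhysics.QuantumLattice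

end
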